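import Mathlib.Analysis.Convex.Segment
import Mathlib.Analysis.Complex.Basic
import Literature.Topology.PlaneTopology.Crosscut
import Literature.Probability.RandomPlanarGeometry.PlanarDomains
import HarnessLib

/-!
# The rational staircase cross-cuts of a Dobrushin domain (target family of the hitting
# tournament) — crux `CardySelfRefinement.LagHandOff` (stmt-CriticalPhenomena-10268), line
# `hitting-tournament`, method step (d) of `stub_quadTransfer`

The tournament rigidity lever (`stub_tournamentRigidity`,
`Theorems/CardySelfRefinementLagHandOffTournamentRigidity.lean`) is applied in the line to a
COUNTABLE family `𝓕` of closed targets with a family `𝓖` of locators separating the points of the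
targets.  This module fixes the recommended family:

* `stairCuts D` — the closures of the connected components of `L ∩ D`, `L` a RATIONAL STAIRCASE
  ARC — a simple arc (`Literature.Topology.PlaneTopology.IsSimpleArc`) which is a finite union of
  axis-parallel segments with endpoints in `ℚ²` (equivalently: the trace of a simple axis-parallel
  polyline with rational vertices, or of a self-avoiding path of some lattice `(1/N) ℤ²`) — with
  both endpoints outside `D` (each member is a closed sub-arc of `L` in `D̄` with its two endpoints
  on `∂D`: a polygonal CROSS-CUT of `D`); countably many;
* `stairLocs D` — the locators: members of `stairCuts D` cut down by closed rational squares;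
* `stub_quadTransfer_stairCutsClosed` — members of `stairCuts D` are closed (hypothesis (i) of
  `stub_tournamentRigidity`);
* `stub_quadTransfer_stairCutsLocSeparating` — `stairLocs D` separates the points of the members of
  `stairCuts D` (hypothesis (ii), `LocSeparating`, verbatim shape): around `z ∈ F` take the closed
  rational square of side `< ε` containing `z` in its interior.

The third hypothesis (`NoIdleRel (stairCuts D) c` for regular curves `c`) is the companion module
`…StairCutsNoIdleRel.lean`.
-/

noncomputable section

open Set Metric
open Literature.Topology.PlaneTopology Literature.Probability.RandomPlanarGeometry

namespace Summit.CriticalPhenomena.CardyFormulaZ2.Cruxes.LagHandOff.HittingTournament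

/-! ### Definitions -/

/-- The point of the plane with rational coordinates `p = (p.1, p.2)`. -/
def ratPt (p : ℚ × ℚ) : ℂ := ⟨p.1, p.2⟩

/-- **The target family `stairCuts D`**: closures of the connected components of `L ∩ D`, for `L` a
RATIONAL STAIRCASE ARC — a simple arc (`IsSimpleArc L a b`) which is a finite union of axis-parallel
segments with endpoints in `ℚ²` (equivalently: the trace of a simple axis-parallel polyline with
rational vertices, or of a self-avoiding path of some lattice `(1/N) ℤ²`) — whose two endpoints
`a`, `b` lie outside `D` (so that every member is a polygonal cross-cut of `D`: a closed sub-arc of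
`L` in `D̄` with its two endpoints on `∂D`). -/
def stairCuts (D : DobrushinDomain) : Set (Set ℂ) :=
  {F | ∃ (L : Set ℂ) (S : Finset ((ℚ × ℚ) × (ℚ × ℚ))) (a b z : ℂ),
    (∀ s ∈ S, s.1.1 = s.2.1 ∨ s.1.2 = s.2.2) ∧ L = ⋃ s ∈ S, segment ℝ (ratPt s.1) (ratPt s.2) ∧
    IsSimpleArc L a b ∧ a ∉ D.carrier ∧ b ∉ D.carrier ∧
    z ∈ L ∩ D.carrier ∧ F = closure (connectedComponentIn (L ∩ D.carrier) z)}

/-- **The locator family `stairLocs D`**: members of `stairCuts D` cut down by closed axis-parallel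
squares with rational centre and rational half-side. -/
def stairLocs (D : DobrushinDomain) : Set (Set ℂ) :=
  {G | ∃ F ∈ stairCuts D, ∃ (p : ℚ × ℚ) (r : ℚ), 0 < r ∧
    G = F ∩ {w : ℂ | |w.re - p.1| ≤ r ∧ |w.im - p.2| ≤ r}}

/-! ### The two cheap hypotheses of tournament rigidity -/

/-- **Members of `stairCuts D` are closed** (hypothesis (i) of `stub_tournamentRigidity`). -/
theorem stub_quadTransfer_stairCutsClosed :
    ∀ D : DobrushinDomain, ∀ F ∈ stairCuts D, IsClosed F := by
  rintro D F ⟨L, S, a, b, z, -, -, -, -, -, -, rfl⟩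
  exact isClosed_closure

/-- **`stairLocs D` separates the points of the members of `stairCuts D`** (hypothesis (ii) of
`stub_tournamentRigidity`, the `LocSeparating` clause in its verbatim shape): around every point
`z` of `F ∈ stairCuts D` there are arbitrarily small locators `G ⊆ F` containing a relative
neighbourhood of `z` in `F` — the trace of `F` on a closed rational square of side `< ε` whose
interior contains `z`. -/
theorem stub_quadTransfer_stairCutsLocSeparating :
    ∀ D : DobrushinDomain, ∀ F ∈ stairCuts D, ∀ z ∈ F, ∀ ε : ℝ, 0 < ε →
      ∃ G ∈ stairLocs D, G ⊆ F ∧ G ⊆ Metric.closedBall z ε ∧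
        ∃ V : Set ℂ, IsOpen V ∧ z ∈ V ∧ V ∩ F ⊆ G := by
  intro D F hF z _ ε hε
  -- a rational half-side `r < ε / 4` and a rational centre within `r / 2` of `z`
  obtain ⟨r, hr0, hrε⟩ := exists_rat_btwn (show (0 : ℝ) < ε / 4 by linarith)
  have hr0' : (0 : ℚ) < r := by exact_mod_cast hr0
  obtain ⟨p₁, hp₁, hp₁'⟩ := exists_rat_btwn (show z.re - r / 2 < z.re + r / 2 by linarith)
  obtain ⟨p₂, hp₂, hp₂'⟩ := exists_rat_btwn (show z.im - r / 2 < z.im + r / 2 by linarith)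
  set Q : Set ℂ := {w : ℂ | |w.re - ((p₁, p₂) : ℚ × ℚ).1| ≤ r ∧ |w.im - ((p₁, p₂) : ℚ × ℚ).2| ≤ r}
    with hQ
  refine ⟨F ∩ Q, ⟨F, hF, (p₁, p₂), r, hr0', rfl⟩, inter_subset_left, ?_, ?_⟩
  · -- the square lies in the `ε`-ball about `z`
    rintro w ⟨-, hw₁, hw₂⟩
    simp only at hw₁ hw₂
    rw [Metric.mem_closedBall]
    have h₁ : |w.re - z.re| ≤ r + r / 2 := by
      rw [abs_le] at hw₁ ⊢; constructor <;> linarith [hw₁.1, hw₁.2]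
    have h₂ : |w.im - z.im| ≤ r + r / 2 := by
      rw [abs_le] at hw₂ ⊢; constructor <;> linarith [hw₂.1, hw₂.2]
    have hd : dist w z ≤ |w.re - z.re| + |w.im - z.im| := by
      rw [Complex.dist_eq]
      simpa only [Complex.sub_re, Complex.sub_im] using Complex.norm_le_abs_re_add_abs_im (w - z)
    linarith
  · -- the open square is a neighbourhood of `z` whose trace on `F` lies in the locator
    refine ⟨{w : ℂ | |w.re - p₁| < r ∧ |w.im - p₂| < r}, ?_, ?_, ?_⟩
    · exact (isOpen_lt (continuous_abs.comp (Complex.continuous_re.sub continuous_const))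
        continuous_const).inter (isOpen_lt (continuous_abs.comp
          (Complex.continuous_im.sub continuous_const)) continuous_const)
    · constructor
      · rw [abs_lt]; constructor <;> linarith
      · rw [abs_lt]; constructor <;> linarith
    · rintro w ⟨⟨hw₁, hw₂⟩, hwF⟩
      exact ⟨hwF, hw₁.le, hw₂.le⟩

end Summit.CriticalPhenomena.CardyFormulaZ2.Cruxes.LagHandOff.HittingTournament

end
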